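import Summits.BirchSwinnertonDyer.BirchSwinnertonDyer.Theses.BiquadraticEisensteinDescent
import Mathlib.LinearAlgebra.Span.Basic
import Mathlib.Data.ZMod.Basic
import HarnessLib

set_option linter.dupNamespace false
set_option autoImplicit false

/-!
# Sketch (crux-ideate seat 1, g8, round 1) — first lemmas of the crux idea
# `genus-geodesic-link` for `HeegnerTwistCouplingInSupply` (stmt-BirchSwinnertonDyer-21381)

The idea realises BOTH conjuncts of the crux on ONE integral homology class
`𝓛(d₁,d′) ∈ H₁(T¹Y₀(N_W), ℤ)` — the genus-character-signed link of closed geodesic-flow orbits of the real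
quadratic discriminant `Δ = d₁·d′` (`d₁` a fixed good Heegner discriminant):
* `τ(𝓛) =` linking number with the trefoil (Rademacher symbol; Zagier 1975 / Ghys 2007)
  `= 48·h(d₁)h(d′)/(w₁w′)` (checked exactly on 70 pairs, falsifiers/zagier_*.py);
* `λ_W(𝓛) = Σ_Q χ(Q)·(modular symbol of f_W along γ_Q) ∝ c_g(|d₁|)c_g(|d′|)`, `c_g(|d|)² ∝ L(W^{d},1)`
  (Kohnen 1985 Thm 3, Gross–Kohnen–Zagier II, Popa 2006).
So the crux follows from JOINT mod-`p` non-vanishing of the two integer coordinates `(τ, λ_W)` of one class.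
Below: (1) the affine-line lemma that turns "full support on a coset" into joint non-vanishing (proved);
(2) the abstract reduction of the crux shape to the two dictionaries + joint residue support (proved, pure logic).
Nothing about BSD is proved here; the dictionaries are hypotheses.
-/

noncomputable section

open scoped Classical

namespace Summit.BirchSwinnertonDyer.BirchSwinnertonDyer.Cruxes.HeegnerTwistCouplingInSupply.SeatOneG8

/-! ## (1) Affine-line lemma: a coset of a subspace is never covered by two affine hyperplanes (char ≠ 2) -/

/-- If some point of the coset `v₀ + A` is off the hyperplane `φ = 0` and some point is off `ψ = 0`, then one
point of `v₀ + A` is off both, provided `2 ≠ 0` in the field (false over `𝔽₂`). This is the combinatorial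
heart of "full support of the genus-link classes mod p ⇒ a Heegner `d′` good for both conjuncts". -/
theorem coset_avoids_two_hyperplanes {K V : Type*} [Field K] [AddCommGroup V] [Module K V]
    (h2 : (2 : K) ≠ 0) (A : Submodule K V) (φ ψ : V →ₗ[K] K) (v₀ : V)
    (hφ : ∃ a ∈ A, φ (v₀ + a) ≠ 0) (hψ : ∃ a ∈ A, ψ (v₀ + a) ≠ 0) :
    ∃ a ∈ A, φ (v₀ + a) ≠ 0 ∧ ψ (v₀ + a) ≠ 0 := by
  obtain ⟨a₁, ha₁, h₁⟩ := hφ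
  obtain ⟨a₂, ha₂, h₂⟩ := hψ
  by_cases hψ₁ : ψ (v₀ + a₁) = 0
  · by_cases hφ₂ : φ (v₀ + a₂) = 0
    · refine ⟨a₁ + (2 : K) • (a₂ - a₁), A.add_mem ha₁ (A.smul_mem _ (A.sub_mem ha₂ ha₁)), ?_, ?_⟩
      · have key : v₀ + (a₁ + (2 : K) • (a₂ - a₁)) = (v₀ + a₁) + (2 : K) • ((v₀ + a₂) - (v₀ + a₁)) := by
          rw [add_sub_add_left_eq_sub]; abel
        rw [key, map_add, map_smul, map_sub, hφ₂, smul_eq_mul]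
        have : φ (v₀ + a₁) + 2 * (0 - φ (v₀ + a₁)) = -φ (v₀ + a₁) := by ring
        rw [this]
        exact neg_ne_zero.mpr h₁
      · have key : v₀ + (a₁ + (2 : K) • (a₂ - a₁)) = (v₀ + a₁) + (2 : K) • ((v₀ + a₂) - (v₀ + a₁)) := by
          rw [add_sub_add_left_eq_sub]; abel
        rw [key, map_add, map_smul, map_sub, hψ₁, smul_eq_mul]
        have : (0 : K) + 2 * (ψ (v₀ + a₂) - 0) = 2 * ψ (v₀ + a₂) := by ring
        rw [this]
        exact mul_ne_zero h2 h₂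
    · exact ⟨a₂, ha₂, hφ₂, h₂⟩
  · exact ⟨a₁, ha₁, h₁, hψ₁⟩

/-- Packet form: if the classes `c i` (genus links indexed by `d′`, `size i = |d′|`) attain EVERY element of the
coset `v₀ + A` beyond any bound, and the coset is not inside either hyperplane, then beyond any bound some
`c i` is off both hyperplanes. -/
theorem fullSupport_joint {K V ι : Type*} [Field K] [AddCommGroup V] [Module K V]
    (h2 : (2 : K) ≠ 0) (A : Submodule K V) (φ ψ : V →ₗ[K] K) (v₀ : V) (c : ι → V) (size : ι → ℕ)
    (hsupp : ∀ a ∈ A, ∀ B : ℕ, ∃ i, B < size i ∧ c i = v₀ + a)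
    (hφ : ∃ a ∈ A, φ (v₀ + a) ≠ 0) (hψ : ∃ a ∈ A, ψ (v₀ + a) ≠ 0) :
    ∀ B : ℕ, ∃ i, B < size i ∧ φ (c i) ≠ 0 ∧ ψ (c i) ≠ 0 := by
  intro B
  obtain ⟨a, ha, h₁, h₂⟩ := coset_avoids_two_hyperplanes h2 A φ ψ v₀ hφ hψ
  obtain ⟨i, hi, hc⟩ := hsupp a ha B
  exact ⟨i, hi, hc ▸ h₁, hc ▸ h₂⟩

/-! ## (2) Abstract reduction: two dictionaries + joint residue support ⇒ the crux shape -/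

/-- The shape of the transfer. Read `τ d` = trefoil linking number of `𝓛(d₁,d)` mod `p`
(`= 48 h(d₁)h(d)/(w₁w) mod p`, Zagier–Ghys), `lam d` = `f_W`-modular-symbol of `𝓛(d₁,d)` mod `𝔭`
(`≠ 0 ⇒ c_g(|d₁|)c_g(|d|) ≠ 0 ⇒ L(W^{d},1) ≠ 0`, Kohnen–GKZ–Waldspurger), `Heeg` = Heegner + local
conditions, `h` = class number. Joint residue support `hJ` then gives the crux conclusion for every bound. -/
theorem cruxShape_of_dictionaries (p : ℕ) (Heeg Lnz : ℤ → Prop) (h : ℤ → ℕ) (τ lam : ℤ → ZMod p)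
    (hτ : ∀ d, Heeg d → (τ d = 0 ↔ p ∣ h d)) (hlam : ∀ d, Heeg d → lam d ≠ 0 → Lnz d)
    (hJ : ∀ B : ℕ, ∃ d, Heeg d ∧ B < d.natAbs ∧ τ d ≠ 0 ∧ lam d ≠ 0) :
    ∀ B : ℕ, ∃ d, Heeg d ∧ B < d.natAbs ∧ ¬ p ∣ h d ∧ Lnz d := by
  intro B
  obtain ⟨d, hd, hB, hτd, hld⟩ := hJ B
  exact ⟨d, hd, hB, fun hdiv => hτd ((hτ d hd).mpr hdiv), hlam d hd hld⟩

/-! ## (3) The transfer C⁺ as a named Prop (informal carrier; to be typed once modular symbols /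
closed geodesics on `Y₀(N)` exist in the library) -/

/-- `[transfer C⁺, informal carrier]` JOINT RESIDUE SUPPORT OF GENUS GEODESIC LINKS.
For `W, p` as in the crux there are a good auxiliary Heegner discriminant `d₁` (`L(W^{d₁},1) ≠ 0`,
`p ∤ h(d₁)`, `|d₁| > 4`) such that for every bound `B` some Heegner `d′`, `|d′| > B`, coprime to `d₁`, has
trefoil-linking number `lk(𝓛(d₁,d′)) = 48 h(d₁)h(d′)/(w₁w′) ≢ 0 (mod p)` AND `f_W`-period of `𝓛(d₁,d′)`
non-zero. Recorded here only as the abstract datum `(τ, lam)` of (2); the honest Lean statement needs the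
Rademacher symbol and weight-2 modular symbols of `Γ₀(N)` (absent from Mathlib 2026-08). -/
def JointResidueSupportShape (p : ℕ) (Heeg : ℤ → Prop) (τ lam : ℤ → ZMod p) : Prop :=
  ∀ B : ℕ, ∃ d, Heeg d ∧ B < d.natAbs ∧ τ d ≠ 0 ∧ lam d ≠ 0


/-! ## (4) The weight-3/2 PENCIL (first rung of the line) and what it leaves

`PencilNonvanishingShape`: every mixed linear combination `a·τ + b·λ` (`(a,b) ≠ (0,0)` over `ZMod p`) is
non-zero beyond every bound in the Heegner family. In the card this is the statement delivered, for each
`(a:b)`, by the Bruinier–Ono–Skinner dichotomy applied to the HOLOMORPHIC weight-3/2 form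
`a·𝔼^{(ℓ₀)} + b·g_W` (Gross's level-`4ℓ₀` Eisenstein series ⊕ the Shimura–Kohnen correspondent of `f_W`),
whose ray non-degeneracy mod `𝔭` is exactly `a_q(W) ≢ 1 + q (mod 𝔭)` for some `q`, i.e. `W[p]` irreducible.
`pencil_dichotomy` records the elementary residue: the pencil forces the joint statement UNLESS both
"off-diagonal" patterns (`p ∤ h ∧ L-bad`, `p ∣ h ∧ L-unit`) occur beyond every bound — so the gap between
the pencil (degree 1, provable) and the crux (degree 2) is precisely quadric (two-axes) avoidance. -/

/-- "beyond every bound some Heegner `d` satisfies `P`". -/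
def IO (Heeg : ℤ → Prop) (P : ℤ → Prop) : Prop := ∀ B : ℕ, ∃ d : ℤ, Heeg d ∧ B < d.natAbs ∧ P d

/-- `[first rung, abstract shape]` the pencil statement. -/
def PencilNonvanishingShape (p : ℕ) (Heeg : ℤ → Prop) (τ lam : ℤ → ZMod p) : Prop :=
  ∀ a b : ZMod p, (a ≠ 0 ∨ b ≠ 0) → IO Heeg (fun d => a * τ d + b * lam d ≠ 0)

theorem pencil_dichotomy (p : ℕ) [Fact p.Prime] (Heeg : ℤ → Prop) (τ lam : ℤ → ZMod p)
    (hP : PencilNonvanishingShape p Heeg τ lam) :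
    JointResidueSupportShape p Heeg τ lam ∨
      (IO Heeg (fun d => τ d ≠ 0 ∧ lam d = 0) ∧ IO Heeg (fun d => τ d = 0 ∧ lam d ≠ 0)) := by
  by_cases hJ : JointResidueSupportShape p Heeg τ lam
  · exact Or.inl hJ
  · right
    unfold JointResidueSupportShape at hJ
    push_neg at hJ
    obtain ⟨B₀, hB₀⟩ := hJ
    refine ⟨fun B => ?_, fun B => ?_⟩
    · obtain ⟨d, hd, hBd, hne⟩ := hP 1 0 (Or.inl one_ne_zero) (max B B₀)
      have hτ : τ d ≠ 0 := by simpa using hne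
      exact ⟨d, hd, lt_of_le_of_lt (le_max_left _ _) hBd, hτ,
        hB₀ d hd (lt_of_le_of_lt (le_max_right _ _) hBd) hτ⟩
    · obtain ⟨d, hd, hBd, hne⟩ := hP 0 1 (Or.inr one_ne_zero) (max B B₀)
      have hl : lam d ≠ 0 := by simpa using hne
      refine ⟨d, hd, lt_of_le_of_lt (le_max_left _ _) hBd, ?_, hl⟩
      by_contra hτ
      exact hl (hB₀ d hd (lt_of_le_of_lt (le_max_right _ _) hBd) hτ)

/-- Conversely the joint statement gives the two axis members of the pencil (and nothing more). -/
theorem pencil_axes_of_joint (p : ℕ) (Heeg : ℤ → Prop) (τ lam : ℤ → ZMod p)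
    (hJ : JointResidueSupportShape p Heeg τ lam) :
    IO Heeg (fun d => τ d ≠ 0) ∧ IO Heeg (fun d => lam d ≠ 0) := by
  refine ⟨fun B => ?_, fun B => ?_⟩
  · obtain ⟨d, hd, hB, hτ, _⟩ := hJ B; exact ⟨d, hd, hB, hτ⟩
  · obtain ⟨d, hd, hB, _, hl⟩ := hJ B; exact ⟨d, hd, hB, hl⟩

end Summit.BirchSwinnertonDyer.BirchSwinnertonDyer.Cruxes.HeegnerTwistCouplingInSupply.SeatOneG8

end
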